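import Mathlib.LinearAlgebra.FiniteDimensional.Lemmas
import Mathlib.LinearAlgebra.Dimension.FreeAndStrongRankCondition
import HarnessLib

/-!
# Planes pairwise meeting in a line form a STAR or lie in a common 3-space
# (the `e = 2` clique dichotomy of qn-p2's THEOREM E2; pure linear algebra)

Cell qa-qnc0 (route `QuantumAdvantage/RingFrame`, crux α = stmt-QuantumAdvantage-19119, tensor line), seat qa-qnc0-lit
gen 10.  Planner qa-qnc0-p2 ROUND-5 §2, THEOREM E2 (co-degree `e = 2`): after the top-layer clique lemma, the
direction planes `S_x` (`2`-dimensional subspaces of `𝔽₂^m`) of the light coset leaders pairwise meet in a line, and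
"by the classification of maximal cliques of the Grassmann graph (Brouwer–Cohen–Neumaier §9.3; self-contained 6-line
proof in the e = 2 case) {S_x} is a STAR (all contain a common line …) or a TOP (all inside a 3-space T)".  In print
this is Chow's theorem / the clique structure of Grassmann graphs (M. Pankov, *Geometry of Semilinear Embeddings*,
§3.2 Prop. 3.3: every maximal clique of `Γ_k(V)` is a star or a top; LIT-MEMO-15 §6).  This file proves the `k = 2`
case needed by E2, over any division ring and in any ambient space, in Mathlib's `Submodule`/`finrank` vocabulary:

`planes_star_or_top`: a family of `2`-dimensional subspaces `P i` such that any two DISTINCT members meet in a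
`1`-dimensional subspace either has a common non-zero vector (STAR) or is contained in one subspace of dimension
`≤ 3` (TOP).

Proof (the planner's six lines): if all planes coincide there is nothing to do; else pick `P₁ ≠ P₂`, `c ≠ 0` spanning
`P₁ ∩ P₂`, `T = P₁ + P₂` (`dim T = 3`).  Every plane `Q` of the family contains `c` or lies in `T` (it meets `P₁`, `P₂`
in non-zero `c₁`, `c₂`; if `c ∉ Q` then `c₁`, `c₂` are independent, span `Q`, and lie in `T`).  If some `Q_a ∌ c`
(so `Q_a ≤ T`) and some `Q_b ≰ T` (so `c ∈ Q_b`), then `Q_a ∩ Q_b ∋ x ≠ 0` with `x ∈ T ∩ Q_b`, a space of dimension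
`≤ 1` containing `c`, so `x ∈ Kc` and `c ∈ Q_a` — contradiction.

WHAT THIS IS NOT: the general-`k` clique classification is not formalised (`TODO(general form)`); nothing about α.
-/

namespace Summit.QuantumAdvantage.AdviceFreeQNC0

namespace PlanesStarTop

open Module Submodule

variable {K V : Type*} [DivisionRing K] [AddCommGroup V] [Module K V]

/-- A `1`-dimensional intersection is spanned by one non-zero common vector. -/
theorem exists_generator_of_finrank_inf_eq_one {S T : Submodule K V} (h : finrank K ↥(S ⊓ T) = 1) :
    ∃ c : V, c ≠ 0 ∧ c ∈ S ∧ c ∈ T ∧ ∀ w, w ∈ S → w ∈ T → ∃ t : K, t • c = w := by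
  obtain ⟨v, hv, hgen⟩ := finrank_eq_one_iff'.1 h
  refine ⟨(v : V), fun h0 => hv (Subtype.ext h0), (mem_inf.1 v.2).1, (mem_inf.1 v.2).2, fun w hS hT => ?_⟩
  obtain ⟨t, ht⟩ := hgen ⟨w, mem_inf.2 ⟨hS, hT⟩⟩
  exact ⟨t, by simpa using congrArg Subtype.val ht⟩

/-- In a space of dimension `≤ 1`, every vector is a multiple of any given non-zero vector. -/
theorem exists_smul_eq_of_finrank_le_one {U : Submodule K V} [FiniteDimensional K U] (h : finrank K U ≤ 1)
    {c x : V} (hc : c ∈ U) (hc0 : c ≠ 0) (hx : x ∈ U) : ∃ t : K, t • c = x := by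
  obtain ⟨v, hgen⟩ := finrank_le_one_iff.1 h
  obtain ⟨s, hs⟩ := hgen ⟨c, hc⟩
  obtain ⟨r, hr⟩ := hgen ⟨x, hx⟩
  have hs' : s • (v : V) = c := by simpa using congrArg Subtype.val hs
  have hr' : r • (v : V) = x := by simpa using congrArg Subtype.val hr
  have hs0 : s ≠ 0 := by
    rintro rfl
    rw [zero_smul] at hs'
    exact hc0 hs'.symm
  refine ⟨r * s⁻¹, ?_⟩
  rw [← hs', smul_smul, mul_assoc, inv_mul_cancel₀ hs0, mul_one, hr']

/-- Two independent vectors of a plane span it; a plane containing two independent vectors of `T` lies in `T`. -/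
theorem le_of_two_mem {Q T : Submodule K V} [FiniteDimensional K Q] (hQ : finrank K Q = 2) {a b : V}
    (ha : a ∈ Q) (hb : b ∈ Q) (haT : a ∈ T) (hbT : b ∈ T) (ha0 : a ≠ 0) (hind : ∀ t : K, t • a ≠ b) : Q ≤ T := by
  -- `span {a, b} = Q`
  have hli : LinearIndependent K ![a, b] := by
    refine LinearIndependent.pair_iff.2 fun s t hst => ?_
    by_contra hne
    rcases eq_or_ne t 0 with rfl | ht
    · rw [zero_smul, add_zero] at hst
      have hs : s ≠ 0 := fun hs => hne ⟨hs, rfl⟩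
      exact ha0 ((smul_eq_zero.1 hst).resolve_left hs)
    · apply hind (-(t⁻¹ * s))
      have : t • b = -(s • a) := eq_neg_of_add_eq_zero_right hst
      calc (-(t⁻¹ * s)) • a = t⁻¹ • (-(s • a)) := by rw [neg_smul, smul_neg, smul_smul]
        _ = t⁻¹ • (t • b) := by rw [this]
        _ = b := by rw [smul_smul, inv_mul_cancel₀ ht, one_smul]
  have hspan_le : span K (Set.range ![a, b]) ≤ Q := by
    rw [span_le]
    rintro _ ⟨i, rfl⟩
    fin_cases i <;> simpa
  have hcard : finrank K ↥(span K (Set.range ![a, b])) = 2 := by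
    rw [finrank_span_eq_card hli]; simp
  have heq : span K (Set.range ![a, b]) = Q := eq_of_le_of_finrank_eq hspan_le (by rw [hcard, hQ])
  rw [← heq, span_le]
  rintro _ ⟨i, rfl⟩
  fin_cases i <;> simpa

end PlanesStarTop

open Module Submodule PlanesStarTop in
/-- **Planes pairwise meeting in a line: STAR or TOP.**  Let `P i` (`i : ι`) be `2`-dimensional subspaces of a
vector space over a division ring such that any two distinct ones meet in a `1`-dimensional subspace.  Then either
some non-zero vector lies in every `P i` (STAR), or all `P i` lie in one subspace of dimension `≤ 3` (TOP).
(The `k = 2` case of the clique classification of Grassmann graphs; qn-p2 ROUND-5 §2, E2 clique step.) -/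
theorem planes_star_or_top {K V : Type*} [DivisionRing K] [AddCommGroup V] [Module K V] {ι : Type*}
    (P : ι → Submodule K V) (h2 : ∀ i, finrank K (P i) = 2)
    (hmeet : ∀ i j, P i ≠ P j → finrank K ↥(P i ⊓ P j) = 1) :
    (∃ c : V, c ≠ 0 ∧ ∀ i, c ∈ P i) ∨
      (∃ T : Submodule K V, FiniteDimensional K T ∧ finrank K T ≤ 3 ∧ ∀ i, P i ≤ T) := by
  haveI hfin : ∀ i, FiniteDimensional K (P i) := fun i => Module.finite_of_finrank_eq_succ (h2 i)
  by_cases hconst : ∀ i j, P i = P j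
  · -- all planes coincide (or there are none): TOP
    rcases isEmpty_or_nonempty ι with hι | ⟨⟨i₀⟩⟩
    · exact Or.inr ⟨⊥, inferInstance, by simp, fun i => (IsEmpty.false i).elim⟩
    · exact Or.inr ⟨P i₀, hfin i₀, by rw [h2 i₀]; norm_num, fun i => (hconst i i₀).le⟩
  push Not at hconst
  obtain ⟨i₁, i₂, hne⟩ := hconst
  -- `c` spans `P i₁ ∩ P i₂`; `T = P i₁ + P i₂` has dimension `3`
  obtain ⟨c, hc0, hc1, hc2, hcgen⟩ := exists_generator_of_finrank_inf_eq_one (hmeet i₁ i₂ hne)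
  obtain ⟨T, hT⟩ : ∃ T : Submodule K V, T = P i₁ ⊔ P i₂ := ⟨_, rfl⟩
  haveI hTfin : FiniteDimensional K T := by rw [hT]; exact Submodule.finiteDimensional_sup _ _
  have hT1 : P i₁ ≤ T := by rw [hT]; exact le_sup_left
  have hT2 : P i₂ ≤ T := by rw [hT]; exact le_sup_right
  have hTdim : finrank K T = 3 := by
    have h := Submodule.finrank_sup_add_finrank_inf_eq (P i₁) (P i₂)
    rw [h2, h2, hmeet i₁ i₂ hne, ← hT] at h
    omega
  -- every plane contains `c` or lies in `T`
  have key : ∀ k, c ∈ P k ∨ P k ≤ T := by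
    intro k
    by_cases hck : c ∈ P k
    · exact Or.inl hck
    right
    have hk1 : P k ≠ P i₁ := fun h => hck (h ▸ hc1)
    have hk2 : P k ≠ P i₂ := fun h => hck (h ▸ hc2)
    obtain ⟨a, ha0, haK, ha1, -⟩ := exists_generator_of_finrank_inf_eq_one (hmeet k i₁ hk1)
    obtain ⟨b, hb0, hbK, hb2, -⟩ := exists_generator_of_finrank_inf_eq_one (hmeet k i₂ hk2)
    refine le_of_two_mem (h2 k) haK hbK (hT1 ha1) (hT2 hb2) ha0 ?_
    -- if `b = t • a` then `b ∈ P i₁ ∩ P i₂ = K c`, so `c ∈ P k`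
    intro t htab
    have hb1 : b ∈ P i₁ := by rw [← htab]; exact smul_mem _ _ ha1
    obtain ⟨s, hs⟩ := hcgen b hb1 hb2
    have hs0 : s ≠ 0 := by rintro rfl; rw [zero_smul] at hs; exact hb0 hs.symm
    apply hck
    have : c = s⁻¹ • b := by rw [← hs, smul_smul, inv_mul_cancel₀ hs0, one_smul]
    rw [this]; exact smul_mem _ _ hbK
  by_cases hstar : ∀ k, c ∈ P k
  · exact Or.inl ⟨c, hc0, hstar⟩
  · push Not at hstar
    obtain ⟨a, hca⟩ := hstar
    have haT : P a ≤ T := (key a).resolve_left hca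
    refine Or.inr ⟨T, hTfin, hTdim.le, fun b => ?_⟩
    rcases key b with hcb | hbT
    · -- `c ∈ P b`; if `P b ≰ T` we reach a contradiction
      by_contra hbT
      have hab : P a ≠ P b := fun h => hca (h ▸ hcb)
      obtain ⟨x, hx0, hxa, hxb, -⟩ := exists_generator_of_finrank_inf_eq_one (hmeet a b hab)
      have hxT : x ∈ T := haT hxa
      -- `P b ⊓ T` is a proper subspace of the plane `P b`, hence of dimension `≤ 1`, and contains `c` and `x`
      have hlt : P b ⊓ T < P b := lt_of_le_of_ne inf_le_left fun h => hbT (h ▸ inf_le_right)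
      haveI : FiniteDimensional K ↥(P b ⊓ T) := Submodule.finiteDimensional_inf_left _ _
      have hdim : finrank K ↥(P b ⊓ T) ≤ 1 := by
        have := Submodule.finrank_lt_finrank_of_lt hlt
        rw [h2 b] at this
        omega
      obtain ⟨t, ht⟩ := exists_smul_eq_of_finrank_le_one hdim (mem_inf.2 ⟨hcb, hT1 hc1⟩)
        hc0 (mem_inf.2 ⟨hxb, hxT⟩)
      have ht0 : t ≠ 0 := by rintro rfl; rw [zero_smul] at ht; exact hx0 ht.symm
      apply hca
      have : c = t⁻¹ • x := by rw [← ht, smul_smul, inv_mul_cancel₀ ht0, one_smul]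
      rw [this]; exact smul_mem _ _ hxa
    · exact hbT

end Summit.QuantumAdvantage.AdviceFreeQNC0
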